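import Literature.AlgebraicGeometry.Resolution.TameCyclicToricDescentModels
import Literature.AlgebraicGeometry.Resolution.RegularLocalRingsNormal
import HarnessLib

/-!
# Local rings at the centre along a field embedding (currency glue for the toric descent step)

Topic: `Literature/AlgebraicGeometry/Resolution`. PROOF side of `CossartPiltant2019ReductionP`
(`ArithmeticalThreefoldsLocal.lean`), input (C4). The toric descent step of [CoP1] Lemma 9.4
(`exists_fixed_model_isRegularLocalRing`, `TameCyclicToricDescentModels.lean`) lives in the
currency `locAtCentre B O ⊆ F` of an abstract valued field `(F, O)` carrying the cyclic
automorphism `σ`, while the reduction `Thm. 1.5 ⇒ Thm. 1.1` (`hKummer` of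
`tameStep_descent_of_kummer`, `ArithmeticalThreefoldsLocalDescentKummer.lean`) lives in an
algebraically closed ambient field `(E, O_E)` of which `F = A(θ)` is a subfield (where `σ`
does NOT extend to an automorphism of finite order). This file is the plumbing between the two:
for an embedding of fields `ι : F → E` and the restricted valuation ring `O_E ∩ F`
(`ValuationSubring.comap`),

* `isRegularLocalRing_locAtCentre_map_iff` — PROVED: `ι` maps the local ring of `B ⊆ F` at the
  centre of `O_E ∩ F` isomorphically onto the local ring of `ι(B)` at the centre of `O_E`
  (`map_locAtCentre_comap`, `ArithmeticalThreefoldsLocalFrameDim.lean`), so one is regular iff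
  the other is;
* `locAtCentre_closure_locAtCentre_union_eq` — PROVED: `((C)_𝔪[Y])_𝔪 = (C[Y])_𝔪`
  (Novacoski–Spivakovsky, Lemma 2.9; the private lemma of `TameCyclicToricDescentModels.lean`
  made available);
* `isUnit_locAtCentre_of_valuation_eq_one` — PROVED: elements of value `0` are units of the
  local ring at the centre;
* `div_mem_locAtCentre_of_pow_mem` — PROVED: a fraction `x/y` of elements of a REGULAR local
  ring at the centre some power of which lies in that ring lies in it (regular local rings are
  normal, Matsumura Thm. 19.4; used to put a root of unity `ζ_ℓ ∈ Frac` into the local ring).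

Everything is PROVED; no named facts are introduced.

## Sources

* J. Novacoski, M. Spivakovsky, *Reduction of local uniformization to the rank one case*
  (2014), Def. 2.8 and Lemma 2.9. [NovacoskiSpivakovsky2014]
* H. Matsumura, *Commutative Ring Theory* (1987), Thm. 19.4. [Matsumura1987]
* V. Cossart, O. Piltant, J. Algebra 320 (2008) 1051–1082, proof of Lemma 9.4 (HAL pp. 28–29).
  [CossartPiltant2008]
-/

noncomputable section

namespace Literature.AlgebraicGeometry.Resolution

universe u

open IsLocalRing

/-! ## The restricted valuation along a field embedding -/

section Comap

variable {F E : Type u} [Field F] [Field E] (OE : ValuationSubring E) (ι : F →+* E)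

/-- **`(B)_{𝔪 ∩ B} ≅ (ι B)_{𝔪 ∩ ι B}` along a field embedding `ι : F → E`** (the local ring at
the centre of `O_E ∩ F`, resp. of `O_E`; `map_locAtCentre_comap`), so **one is a regular local
ring iff the other is**. [cite: NovacoskiSpivakovsky2014, Def. 2.8] -/
theorem isRegularLocalRing_locAtCentre_map_iff (B : Subring F) :
    IsRegularLocalRing (locAtCentre B (OE.comap ι)) ↔
      IsRegularLocalRing (locAtCentre (B.map ι) OE) := by
  let e : locAtCentre B (OE.comap ι) ≃+* locAtCentre (B.map ι) OE :=
    ((locAtCentre B (OE.comap ι)).equivMapOfInjective ι ι.injective).trans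
      (RingEquiv.subringCongr (map_locAtCentre_comap OE ι B))
  exact ⟨fun _ => IsRegularLocalRing.of_ringEquiv e, fun _ => IsRegularLocalRing.of_ringEquiv e.symm⟩

end Comap

/-! ## Three facts about local rings at the centre -/

section Centre

variable {F : Type u} [Field F] (O : ValuationSubring F)

/-- `((C)_𝔪[Y])_𝔪 = (C[Y])_𝔪`: localising at the centre before adjoining further elements of `O`
does not change the final local ring (Novacoski–Spivakovsky, Lemma 2.9).
[cite: NovacoskiSpivakovsky2014, Lemma 2.9] -/
theorem locAtCentre_closure_locAtCentre_union_eq (C : Subring F) (Y : Set F) :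
    locAtCentre (Subring.closure ((locAtCentre C O : Set F) ∪ Y)) O =
      locAtCentre (Subring.closure ((C : Set F) ∪ Y)) O := by
  have hCC : C ≤ Subring.closure ((C : Set F) ∪ Y) := fun x hx => Subring.subset_closure (Or.inl hx)
  apply le_antisymm
  · have h1 : Subring.closure ((locAtCentre C O : Set F) ∪ Y) ≤
        locAtCentre (Subring.closure ((C : Set F) ∪ Y)) O := by
      refine Subring.closure_le.mpr (Set.union_subset (locAtCentre_mono O hCC) ?_)
      intro x hx
      exact le_locAtCentre _ O (Subring.subset_closure (Or.inr hx))
    exact (locAtCentre_mono O h1).trans (locAtCentre_locAtCentre _ O).le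
  · refine locAtCentre_mono O (Subring.closure_le.mpr ?_)
    rintro x (hx | hx)
    · exact Subring.subset_closure (Or.inl (le_locAtCentre _ O hx))
    · exact Subring.subset_closure (Or.inr hx)

/-- Elements of value `0` are units of the local ring at the centre `R'_{m'} = {x/y | y ∉ m'}`
(Novacoski–Spivakovsky, Def. 2.8 (1)). [cite: NovacoskiSpivakovsky2014, Def. 2.8] -/
theorem isUnit_locAtCentre_of_valuation_eq_one {B : Subring F} (h : B ≤ O.toSubring)
    (x : locAtCentre B O) (hv : O.valuation (x : F) = 1) : IsUnit x := by
  by_contra hnu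
  have hlt := (not_isUnit_locAtCentre_iff h x).mp hnu
  rw [hv] at hlt
  exact lt_irrefl _ hlt

/-- **A fraction of elements of a regular local ring at the centre, a power of which lies in
that ring, lies in it** — regular local rings are normal (Matsumura, Thm. 19.4): if `y^n ∣ x^n`
then `y ∣ x`. (Used for the root of unity `ζ_ℓ = x/y` of [CoP1] Lemma 9.4: "We have
`k(ζ_l) ⊂ S`".) [cite: Matsumura1987, Thm. 19.4] -/
theorem div_mem_locAtCentre_of_pow_mem {B : Subring F}
    (hreg : IsRegularLocalRing (locAtCentre B O)) {x y : F}
    (hx : x ∈ locAtCentre B O) (hy : y ∈ locAtCentre B O) {n : ℕ} (hn : n ≠ 0)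
    (han : (x / y) ^ n ∈ locAtCentre B O) : x / y ∈ locAtCentre B O := by
  classical
  set T := locAtCentre B O with hT
  haveI := hreg
  haveI : IsDomain T := isDomain_of_isRegularLocalRing T
  haveI := isIntegrallyClosed_of_isRegularLocalRing T
  by_cases hy0 : y = 0
  · rw [hy0, div_zero]
    exact T.zero_mem
  have hdvd : (⟨y, hy⟩ : T) ^ n ∣ (⟨x, hx⟩ : T) ^ n := by
    refine ⟨⟨(x / y) ^ n, han⟩, Subtype.ext ?_⟩
    push_cast
    rw [div_pow, mul_div_cancel₀ _ (pow_ne_zero n hy0)]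
  obtain ⟨t, ht⟩ := (IsIntegrallyClosed.pow_dvd_pow_iff hn).mp hdvd
  have ht' : x = y * (t : F) := by
    have := congrArg (fun z : T => (z : F)) ht
    simpa using this
  have hat : x / y = t := by
    rw [ht', mul_div_cancel_left₀ _ hy0]
  rw [hat]
  exact t.2

end Centre

end Literature.AlgebraicGeometry.Resolution

end
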